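import Mathlib
import Summits.Schanuel.Schanuel.Theses.CoprimeExpPolynomials

/-!
# Birth skeleton (BC3) — crux `CoprimeExpPolynomialsNoCommonZero` (item stmt-Schanuel-3763)
# of route `CoprimeExpPolynomials`; registrar `planner-skel-stmt-Schanuel-3763-0`, 2026-08-17

The crux (Jossen's Conjecture 1.1(ii) on the Ritt ring; zero-set form of rank-one Schanuel):
two relatively prime `P, Q ∈ ℚ̄[X₀, …, Xₙ]` have no common zero at a point
`q(z) = (z, e^{β₁ z}, …, e^{βₙ z})` with `z ≠ 0` and `β₁, …, βₙ ∈ ℚ̄` linearly independent over `ℚ`.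

## The line: coprime hinge + the "generic point / logarithmic point" dichotomy

Write `w = (e^{βᵢ z})ᵢ` and `𝕂 = ℚ̄ = ↥(algebraicClosure ℚ ℂ)` (the crux's coefficient field).
Three registered stubs, none of which mentions transcendence degree (only algebraic independence of
coordinate subfamilies, so that the composition is elementary):

* `stub_coprimeHinge` — `CoprimeHinge` (commutative algebra, PROVABLE NOW, size M): two relatively
  prime polynomials over `ℚ̄` in `n + 1` variables have no common zero `x ∈ ℂⁿ⁺¹` of transcendence
  degree `≥ n` over `ℚ̄`; concretely, at a common zero EVERY `n`-subfamily `k ↦ x (j.succAbove k)` is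
  algebraically dependent over `ℚ̄`.  (If `x ∘ j.succAbove` were independent, `x j` is algebraic over
  the purely transcendental field `ℚ̄(x ∘ j.succAbove)` — `P ≠ 0` since `IsRelPrime 0 Q` makes `Q` a
  unit, which does not vanish; the primitive minimal polynomial `F ∈ ℚ̄[X]` of `x j` divides every
  relation of `x` by Gauss's lemma in the UFD `ℚ̄[X_{≠ j}][X_j]`, so `F ∣ P` and `F ∣ Q` with `F` a
  non-unit, contradicting `IsRelPrime P Q`.)  This is the algebra behind the route's support item
  `CoprimeOfRankOne` (stmt-Schanuel-3767), cut below `Algebra.trdeg` so no dimension theory is needed.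
* `stub_pureExponentials` — `PureExponentials` (OPEN from three frequencies on; the GENERIC sector):
  at `z ≠ 0`, among `m + 1` exponentials `e^{β₀ z}, …, e^{β_m z}` with `ℚ`-linearly independent
  algebraic frequencies, some `m` are algebraically independent over `ℚ̄` — i.e.
  `trdeg_ℚ̄ ℚ̄(e^{β z}) ≥ m`, the homogeneous (no `X₀`) shadow of rank-one Schanuel.  `m + 1 = 1`:
  trivial; `m + 1 = 2`: Hermite–Lindemann + Gel'fond–Schneider (`e^{β₁ z} = (e^{β₀ z})^{β₁/β₀}`);
  `m + 1 = 3` already contains the algebraic independence of `2^{√2}, 2^{√3}` (open; Gel'fond 1949 /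
  Diaz 1989 / Philippon reach only frequency sets `1, β, …, β^{d-1}` and only `⌈d/2⌉`-type bounds).
  This is the sector where the criteria for algebraic independence (Nesterenko–Philippon Ch. 14) bite.
* `stub_logarithmicPoint` — `LogarithmicPoint` (OPEN from two frequencies on; the LOGARITHMIC sector):
  if `z ≠ 0` is ALGEBRAIC over `m` algebraically independent exponentials `e^{β_k z}` (`k ≠ i`) —
  encoded as: that subfamily is independent but `Fin.cons z (that subfamily)` is not — then the
  remaining exponential `e^{βᵢ z}` is transcendental over them: all `m + 1` exponentials are
  algebraically independent over `ℚ̄`.  "Lindemann–Weierstrass at points algebraic over the other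
  exponentials": `m = 0` IS Hermite–Lindemann (`z ∈ ℚ̄ ∖ 0 ⟹ e^{β z} ∉ ℚ̄`); `m = 1` contains
  Gel'fond's conjecture (`β = (1, √2)`, `z = log 2`, `i = 0`: `log 2, 2^{√2}` algebraically
  independent) and `(π, e^{π√2})`; it is the sector of the route's cruxes `DilationRigidity` /
  `LogAlphaAlphaBetaAlgIndep` and of the Gel'fond–Schneider–Baker / Siegel–Shidlovskii engines.

Composition (`noCommonZero_of_parts`, sorry-free; `CoprimeExpPolynomialsNoCommonZero_of` plugs the three
stubs in and concludes the crux BY NAME; `CoprimeExpPolynomialsNoCommonZero_of_parts` is the implication form): at a putative common zero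
`q = Fin.cons z w` with `z ≠ 0`, the hinge makes every `n`-subfamily of `q` dependent over `ℚ̄`.
`n = 0`: the empty family is independent — contradiction (coprime univariate polynomials over `ℚ̄`
have no common complex zero).  `n = m + 1`: `PureExponentials` gives `i` with `w ∘ i.succAbove`
independent; either `Fin.cons z (w ∘ i.succAbove)` is independent — it IS the subfamily
`q ∘ i.succ.succAbove`, contradiction — or it is not, and `LogarithmicPoint` makes
`w = q ∘ (0 : Fin (m+2)).succAbove` independent, contradiction.

Why this cut and not `RankOneSchanuel ∧ CoprimeOfRankOne` (the route's own hinge, which would restate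
the crux in one stub): both open stubs are consequences of rank-one Schanuel that look STRICTLY weaker,
each is the home of a different classical engine, and neither gives the crux on its own — a point with
`z` transcendental over `ℚ̄(w)` and `trdeg ℚ̄(w) = n − 2` would break only `PureExponentials`, while an
algebraic dependence between `log 2` and `2^{√2}` would break only `LogarithmicPoint`.

Disproof used: none relevant — no `Cruxes/CoprimeExpPolynomialsNoCommonZero/Disproof.lean` exists at
registration (`ledger crux ls stmt-Schanuel-3763`: no workfiles); `ledger negatives --problem Schanuel`
lists only the two PolarPhantoms statements `trdeg ℚ(y, α) < n` (stmt-Schanuel-6844/6846), which no stub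
here instantiates (every stub asserts algebraic INdependence / non-vanishing, never an upper bound).
-/

noncomputable section

set_option linter.dupNamespace false

namespace Summit.Schanuel.Schanuel.Cruxes.CoprimeExpPolynomialsNoCommonZero.Birth

open Summit.Schanuel.Schanuel.Theses.CoprimeExpPolynomials (CoprimeExpPolynomialsNoCommonZero)

/-! ## Stub statements -/

/-- HINGE (provable now, commutative algebra in the UFD `ℚ̄[X₀, …, Xₙ]`): two relatively prime
polynomials over `ℚ̄ = ↥(algebraicClosure ℚ ℂ)` in `n + 1` variables vanish simultaneously at no point
`x ∈ ℂⁿ⁺¹` having `n` coordinates algebraically independent over `ℚ̄` (every `n`-subfamily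
`k ↦ x (j.succAbove k)` of a common zero is algebraically dependent; `trdeg_ℚ̄ ℚ̄(x) ≤ n − 1`). -/
def CoprimeHinge : Prop :=
  ∀ (n : ℕ) (x : Fin (n + 1) → ℂ) (P Q : MvPolynomial (Fin (n + 1)) ↥(algebraicClosure ℚ ℂ)),
    IsRelPrime P Q → MvPolynomial.aeval x P = 0 → MvPolynomial.aeval x Q = 0 →
      ∀ j : Fin (n + 1),
        ¬ AlgebraicIndependent (↥(algebraicClosure ℚ ℂ)) (fun k : Fin n => x (j.succAbove k))

/-- GENERIC SECTOR (open for `m + 1 ≥ 3`): at `z ≠ 0`, among `m + 1` exponentials `e^{βₖ z}` with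
`ℚ`-linearly independent algebraic frequencies `β₀, …, β_m`, some `m` of them are algebraically
independent over `ℚ̄` (`trdeg_ℚ̄ ℚ̄(e^{β₀ z}, …, e^{β_m z}) ≥ m`). -/
def PureExponentials : Prop :=
  ∀ (m : ℕ) (β : Fin (m + 1) → ↥(algebraicClosure ℚ ℂ)) (z : ℂ), LinearIndependent ℚ β → z ≠ 0 →
    ∃ i : Fin (m + 1),
      AlgebraicIndependent (↥(algebraicClosure ℚ ℂ))
        (fun k : Fin m => Complex.exp ((β (i.succAbove k) : ℂ) * z))

/-- LOGARITHMIC SECTOR (open for `m + 1 ≥ 2`; `m = 0` is Hermite–Lindemann): if `z ≠ 0` is algebraic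
over `m` algebraically independent exponentials `e^{βₖ z}`, `k ≠ i` (encoded: the subfamily is
independent over `ℚ̄` but `Fin.cons z (subfamily)` is not), then the remaining exponential `e^{βᵢ z}`
is transcendental over them — all `m + 1` exponentials are algebraically independent over `ℚ̄`. -/
def LogarithmicPoint : Prop :=
  ∀ (m : ℕ) (β : Fin (m + 1) → ↥(algebraicClosure ℚ ℂ)) (z : ℂ) (i : Fin (m + 1)),
    LinearIndependent ℚ β → z ≠ 0 →
    AlgebraicIndependent (↥(algebraicClosure ℚ ℂ))
        (fun k : Fin m => Complex.exp ((β (i.succAbove k) : ℂ) * z)) →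
    ¬ AlgebraicIndependent (↥(algebraicClosure ℚ ℂ))
        (Fin.cons z (fun k : Fin m => Complex.exp ((β (i.succAbove k) : ℂ) * z)) :
          Fin (m + 1) → ℂ) →
    AlgebraicIndependent (↥(algebraicClosure ℚ ℂ))
        (fun k : Fin (m + 1) => Complex.exp ((β k : ℂ) * z))

/-! ## Registered stubs -/

/-- STUB 1 (size M, provable now): the coprime hinge `CoprimeHinge` — Gauss's lemma for the primitive
minimal polynomial of the one dependent coordinate over the purely transcendental `ℚ̄(x ∘ j.succAbove)`;
`P = 0` is excluded because `IsRelPrime 0 Q` forces `Q` to be a unit. -/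
theorem stub_coprimeHinge : CoprimeHinge := by
  sorry

/-- STUB 2 (size XL, OPEN in general; `m + 1 ≤ 2` = Hermite–Lindemann + Gel'fond–Schneider): the
generic sector `PureExponentials`, `trdeg_ℚ̄ ℚ̄(e^{β₀ z}, …, e^{β_m z}) ≥ m` at `z ≠ 0`. -/
theorem stub_pureExponentials : PureExponentials := by
  sorry

/-- STUB 3 (size XL, OPEN in general; `m = 0` = Hermite–Lindemann, `m = 1` ⊇ Gel'fond's conjecture):
the logarithmic sector `LogarithmicPoint`, Lindemann–Weierstrass at points algebraic over the other
exponentials. -/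
theorem stub_logarithmicPoint : LogarithmicPoint := by
  sorry

/-! ## Composition (sorry-free) -/

/-- The composition with the three parts as hypotheses, concluding the crux's statement verbatim
(the body of `CoprimeExpPolynomialsNoCommonZero` as written in the route file).  `n = 0`: the hinge at
`j = 0` contradicts the independence of the empty family.  `n = m + 1`: `PureExponentials` gives `i`
with `w ∘ i.succAbove` independent; either `Fin.cons z (w ∘ i.succAbove) = q ∘ i.succ.succAbove` is
independent (hinge at `j = i.succ`), or `LogarithmicPoint` makes `w = q ∘ (0 : Fin (m+2)).succAbove`
independent (hinge at `j = 0`). -/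
theorem noCommonZero_of_parts (hH : CoprimeHinge) (hA : PureExponentials) (hB : LogarithmicPoint) :
    ∀ (n : ℕ) (β : Fin n → ↥(algebraicClosure ℚ ℂ))
      (P Q : MvPolynomial (Fin (n + 1)) ↥(algebraicClosure ℚ ℂ)), LinearIndependent ℚ β →
      IsRelPrime P Q → ∀ z : ℂ, z ≠ 0 →
        MvPolynomial.aeval (Fin.cons z fun i => Complex.exp ((β i : ℂ) * z)) P = 0 →
        MvPolynomial.aeval (Fin.cons z fun i => Complex.exp ((β i : ℂ) * z)) Q ≠ 0 := by
  intro n β P Q hβ hPQ z hz hP hQ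
  have hdep := hH n _ P Q hPQ hP hQ
  cases n with
  | zero =>
    exact hdep 0 algebraicIndependent_empty_type
  | succ m =>
    obtain ⟨i, hi⟩ := hA m β z hβ hz
    by_cases hcons : AlgebraicIndependent (↥(algebraicClosure ℚ ℂ))
        (Fin.cons z (fun k : Fin m => Complex.exp ((β (i.succAbove k) : ℂ) * z)) :
          Fin (m + 1) → ℂ)
    · refine hdep i.succ ?_
      convert hcons using 1
      funext k
      refine Fin.cases ?_ (fun l => ?_) k
      · simp
      · simp [Fin.succ_succAbove_succ]
    · refine hdep 0 ?_
      convert hB m β z i hβ hz hi hcons using 1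
      funext k
      simp [Fin.zero_succAbove]

/-- **The skeleton concludes the crux BY NAME**: `CoprimeExpPolynomialsNoCommonZero` (route
`CoprimeExpPolynomials`, stmt-Schanuel-3763) from the three registered stubs; its only `sorry`s are
inside `stub_coprimeHinge`, `stub_pureExponentials`, `stub_logarithmicPoint`. -/
theorem CoprimeExpPolynomialsNoCommonZero_of : CoprimeExpPolynomialsNoCommonZero :=
  noCommonZero_of_parts stub_coprimeHinge stub_pureExponentials stub_logarithmicPoint

/-- The same composition in implication form (sorry-free, axioms `propext`, `Classical.choice`,
`Quot.sound`): the three stub statements imply the crux by name. -/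
theorem CoprimeExpPolynomialsNoCommonZero_of_parts :
    CoprimeHinge → PureExponentials → LogarithmicPoint → CoprimeExpPolynomialsNoCommonZero :=
  noCommonZero_of_parts

end Summit.Schanuel.Schanuel.Cruxes.CoprimeExpPolynomialsNoCommonZero.Birth

end
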